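import Summits.ResolutionOfSingularities.ResolutionOfSingularities.Theorems.MarkedTransferCampaignW36ConeDatum
import Literature.RingTheory.GradedAlgebra.SymbolicReesNotNoetherian
import HarnessLib

/-!
# [L1 W3.6 lineage · R12/12a trigger (u)] The cone datum over a SANNAI–TANAKA prime: NO core focusing, MODULO ⟨hSig⟩ and the NAMED FACT
# `SannaiTanaka2019_Thm1_2` (the hypothesis `hfg` of `CampaignW36.not_exists_isCoreFocus_cone` discharged BY NAME)

Cell `res-hironaka`, rung L, slot W3.6 lineage (seat res-L1-s36-pv-2 g2); GAP-LEDGER R12/12a, res-adj-3's sub-entry (u′) 2026-08-27T12:46:47Z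
«12a @ cone datum E_{𝔭₀,M}: DOES-NOT-FOLLOW-AS-TYPED MODULO-⟨hSig⟩ ∧ ⟨hfg⟩ … WHAT WOULD MAKE IT OUTRIGHT: hSig in the kernel AND hfg either
typed or admitted as a Literature NAMED FACT». This file does the second half: `hfg` := the typed named fact
`Literature.RingTheory.GradedAlgebra.SannaiTanaka2019_Thm1_2` (A. Sannai – H. Tanaka, Algebra & Number Theory 13 (2019), Thm 1.2: over
every field a prime of the polynomial ring in twelve variables has a NON-Noetherian symbolic Rees algebra; typed AS PRINTED, p533809),
read through the bridges `symbPow_eq_satPow` / `symbolicReesAlgebra_eq_familySubalgebra` (the fact's neutral `P^m A_P ∩ A` and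
`⊕ P^{(m)} T^m` ARE res-type-010's `satPow` and row 003's `familySubalgebra`). HOST item stmt-ResolutionOfSingularities-16155 via
`--supports`. HONEST FRAMING (D-0012/D-0089): a CONDITIONAL negative — hypotheses = the published fact (as a `Prop` binder, NOT proved in
the tree) and (K2) `Inv`-constancy along the cone cut (hSig, UNVERIFIED); nothing of [Hironaka2017] is asserted; the CLASS word is the
director's; AI-produced kernel proofs, weaker than expert review.
-/

noncomputable section

set_option linter.dupNamespace false -- mandated namespace of this single-conjunct summit

open _root_.AlgebraicGeometry _root_.TopologicalSpace _root_.CategoryTheory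

namespace Summit.ResolutionOfSingularities.ResolutionOfSingularities.Theorems

open Literature.AlgebraicGeometry.Resolution
open Literature.AlgebraicGeometry.Hironaka2017
open Literature.AlgebraicGeometry.Hironaka2017.S02Preliminaries
open Literature.AlgebraicGeometry.Hironaka2017.S04CharAlgebra
open Literature.AlgebraicGeometry.Hironaka2017.S06BaseHike
open Literature.AlgebraicGeometry.Hironaka2017.Datum
open Literature.AlgebraicGeometry.Hironaka2017.DiffPowerStalk
open Literature.AlgebraicGeometry.Hironaka2017.TransversalSaturation
open Literature.AlgebraicGeometry.Hironaka2017.SpecOrders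
open Literature.RingTheory.GradedAlgebra
open Scheme.IdealSheafData

universe u

namespace CampaignW36

section Bridges

variable {A : Type u} [CommRing A]

/-- Sannai–Tanaka's `P^{(m)} = P^m A_P ∩ A` (`Literature.RingTheory.GradedAlgebra.symbPow`) IS res-type-010's choice-free `satPow P m`.
[cite: SannaiTanaka2019, Question 1.1 (p.1879)] -/
theorem symbPow_eq_satPow (P : Ideal A) [P.IsPrime] (m : ℕ) : symbPow P m = satPow P m := by
  ext x
  rw [mem_symbPow_iff, mem_satPow_iff]

/-- The symbolic Rees algebra `⊕ P^{(m)} T^m` (`symbolicReesAlgebra`) IS the family algebra `familySubalgebra A (satPow P ·)` of row 003.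
[cite: SannaiTanaka2019, Question 1.1 (p.1879)] -/
theorem symbolicReesAlgebra_eq_familySubalgebra (P : Ideal A) [P.IsPrime] :
    symbolicReesAlgebra P = familySubalgebra A fun d => satPow P d := by
  apply Subalgebra.ext
  intro f
  rw [mem_symbolicReesAlgebra_iff, mem_familySubalgebra_iff_coeff _ (satPow_zero P) (satPow_mul_le P)]
  simp only [symbPow_eq_satPow]

/-- The fact in the cell's currency: `SannaiTanaka2019_Thm1_2` gives, over every field `k`, a prime `𝔭₀ ⊂ k[x₁,…,x₁₂]` with
`¬ (familySubalgebra _ (satPow 𝔭₀ ·)).FG` — exactly the hypothesis `hfg` of `not_exists_isCoreFocus_cone`. [cite: SannaiTanaka2019, Thm 1.2 (p.1879)] -/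
theorem exists_prime_not_fg_familySubalgebra_satPow_of_SannaiTanaka (hST : SannaiTanaka2019_Thm1_2.{u}) (k : Type u) [Field k] :
    ∃ (𝔭₀ : Ideal (MvPolynomial (Fin 12) k)) (_ : 𝔭₀.IsPrime),
      ¬ (familySubalgebra (MvPolynomial (Fin 12) k) fun d => satPow 𝔭₀ d).FG := by
  obtain ⟨P, hP, hN⟩ := exists_not_fg_symbolicReesAlgebra_of_SannaiTanaka hST k
  refine ⟨P, hP, ?_⟩
  rw [← symbolicReesAlgebra_eq_familySubalgebra]
  exact hN

end Bridges

section Cone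

variable (K : Type u) [Field K]

/-- **The (u) device over a Sannai–Tanaka prime — MODULO ⟨hSig⟩ AND THE NAMED FACT ONLY.** Over a perfect field `K` of characteristic
`p`, granted `SannaiTanaka2019_Thm1_2` there is a prime `𝔭₀ ⊂ K[x₁,…,x₁₂]` such that for every `M ≥ 2` the cone datum
`E = ((x₀²) + (𝔭₀ R)^M, 2)` on `𝔸¹³ = Spec K[x₀,…,x₁₂]` (`Ê = E`, `Sing(E) = V(𝔭₀) × {0}` — `MarkedTransferCampaignW36ConeDatum`) has NO
core focusing `Ě` for ANY `inv` bundle whose `Inv_max`-stratum on `Sing(E)_cl` is all of `Sing(E)_cl` (hSig — the one remaining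
UNVERIFIED modulus, res-type-009 §6 (J1′)–(J3′)). [cite: SannaiTanaka2019, Thm 1.2 (p.1879)] -/
theorem exists_prime_not_exists_isCoreFocus_cone_of_SannaiTanaka (hST : SannaiTanaka2019_Thm1_2.{u}) (p : ℕ) [Fact p.Prime]
    [CharP K p] [PerfectField K] :
    ∃ (𝔭₀ : Ideal (MvPolynomial (Fin 12) K)) (_ : 𝔭₀.IsPrime), ∀ (M : ℕ), 2 ≤ M →
      ∀ (P J : Ideal (MvPolynomial (Fin (12 + 1)) K)),
        P = 𝔭₀.map (MvPolynomial.rename Fin.succ : MvPolynomial (Fin 12) K →ₐ[K] MvPolynomial (Fin (12 + 1)) K).toRingHom ⊔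
          Ideal.span {MvPolynomial.X 0} →
        J = Ideal.span {MvPolynomial.X 0 ^ 2} ⊔
          (𝔭₀.map (MvPolynomial.rename Fin.succ : MvPolynomial (Fin 12) K →ₐ[K] MvPolynomial (Fin (12 + 1)) K).toRingHom) ^ M →
        ∀ {m : ℕ} (inv : IdealExponent (Zs (MvPolynomial (Fin (12 + 1)) K)) → Zs (MvPolynomial (Fin (12 + 1)) K) → EdgeInv m),
          invmaxStratum
              ((⟨shf (MvPolynomial (Fin (12 + 1)) K) J, 2⟩ : IdealExponent (Zs (MvPolynomial (Fin (12 + 1)) K))).sing ∩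
                S02Preliminaries.closedPoints (Zs (MvPolynomial (Fin (12 + 1)) K)))
              (inv ⟨shf (MvPolynomial (Fin (12 + 1)) K) J, 2⟩) =
            (⟨shf (MvPolynomial (Fin (12 + 1)) K) J, 2⟩ : IdealExponent (Zs (MvPolynomial (Fin (12 + 1)) K))).sing ∩
              S02Preliminaries.closedPoints (Zs (MvPolynomial (Fin (12 + 1)) K)) →
          ¬ ∃ Echeck : IdealExponent (Zs (MvPolynomial (Fin (12 + 1)) K)),
            IsCoreFocus S04CharAlgebra.pAlg inv ⟨shf (MvPolynomial (Fin (12 + 1)) K) J, 2⟩ Echeck := by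
  obtain ⟨𝔭₀, h𝔭₀, hN⟩ := exists_prime_not_fg_familySubalgebra_satPow_of_SannaiTanaka hST K
  exact ⟨𝔭₀, h𝔭₀, fun M hM P J hP hJ m inv hSig => not_exists_isCoreFocus_cone K 12 M 𝔭₀ P J p hM hP hJ inv hSig hN⟩

/-- The same over res-L1-s36-pv-1's typed datum `ConeDatum.E K 12 𝔭₀ M` (p530622). [cite: SannaiTanaka2019, Thm 1.2 (p.1879)] -/
theorem exists_prime_not_exists_isCoreFocus_coneDatumE_of_SannaiTanaka (hST : SannaiTanaka2019_Thm1_2.{u}) (p : ℕ) [Fact p.Prime]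
    [CharP K p] [PerfectField K] :
    ∃ (𝔭₀ : Ideal (MvPolynomial (Fin 12) K)) (_ : 𝔭₀.IsPrime), ∀ (M : ℕ), 2 ≤ M →
      ∀ {m : ℕ} (inv : IdealExponent (ConeDatum.Z K 12) → ConeDatum.Z K 12 → EdgeInv m),
        invmaxStratum ((ConeDatum.E K 12 𝔭₀ M).sing ∩ S02Preliminaries.closedPoints (ConeDatum.Z K 12)) (inv (ConeDatum.E K 12 𝔭₀ M)) =
            (ConeDatum.E K 12 𝔭₀ M).sing ∩ S02Preliminaries.closedPoints (ConeDatum.Z K 12) →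
        ¬ ∃ Echeck : IdealExponent (ConeDatum.Z K 12), IsCoreFocus S04CharAlgebra.pAlg inv (ConeDatum.E K 12 𝔭₀ M) Echeck := by
  obtain ⟨𝔭₀, h𝔭₀, hN⟩ := exists_prime_not_fg_familySubalgebra_satPow_of_SannaiTanaka hST K
  exact ⟨𝔭₀, h𝔭₀, fun M hM m inv hSig => not_exists_isCoreFocus_coneDatumE K 12 M 𝔭₀ p hM inv hSig hN⟩

end Cone

end CampaignW36

end Summit.ResolutionOfSingularities.ResolutionOfSingularities.Theorems

end
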